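import Summits.NavierStokesRegularity.NavierStokesRegularity.Theorems.PoloidalWindowDoorPoloidalWindowRigidityZShockRangeLocal
import Summits.NavierStokesRegularity.NavierStokesRegularity.Theorems.PoloidalWindowDoorPoloidalWindowRigidityZShockRangeLocalAntitone
import HarnessLib

/-!
# Crux K2 `PoloidalWindowRigidity` (stmt-NavierStokesRegularity-19708), line `z_shock` — R2 / R2½ IN THE ANALYTIC CATEGORY OF THE CLASS:
# an analytic, positive, monotone, NON-CONSTANT structure function on the compact value hull suffices

`--supports stmt-NavierStokesRegularity-19708 --as helper` (leafhand-ns-poloidalwindowdoor-3 g8, cell decomp-ns, 2026-08-31).  Class-free,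
def-free, Mathlib + tree files only.  **No stub and no summit is closed by this file; Navier–Stokes regularity is NOT proved here (rung 0).**

WHY THIS FILE.  The class delivers the slope function of the autonomous thick window as a REAL-ANALYTIC function at the values of the slice
(`…ZShockHeightEvolution.heightEvolution_of_class_autonomy`), and the thick/twist clauses only say that it is not affine (genuine nonlinearity
SOMEWHERE).  The range-local rungs of `…ZShockRangeLocal` / `…ZShockRangeLocalAntitone` still carry four quantitative structure hypotheses
(`κlo`, `k₁`, continuity of `κ'`, «`κ'` not identically zero on every open subinterval»).  In the analytic category all four are AUTOMATIC
from qualitative data on the compact hull `[A, B]`: positivity, a sign of `deriv κ`, and `κ A ≠ κ B` (compactness gives the constants; the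
identity principle `…ZShockRangeLocal.gn_deriv_of_analyticOnNhd` turns «non-constant» into genuine nonlinearity on every subinterval).  So the
1-D shadow (R2) and the supersonic oblique profiles (R2½) of the z_shock column are constant as soon as the analytic slope function is
one-signed-thick and non-affine on the value hull — the exact currency of the stub:

* `scalarWave_const_of_analytic_speed` / `scalarWave_const_of_analytic_speed_antitone` — R2, scalar currency: `κ` analytic at every point
  of `[A, B] ⊇ range w`, `κ > 0` on `[A, B]`, `deriv κ ≥ 0` (resp. `≤ 0`) on `[A, B]`, `κ A ≠ κ B`; `w` two-sided `C²`, `w_x, w_z` bounded ⇒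
  `w` constant;
* `obliqueProfile_const_of_analytic_speed` / `obliqueProfile_const_of_analytic_speed_antitone` — R2½: `γ` analytic on `[A, B] ⊇ range Φ`,
  `0 < γ < κ₀²` on `[A, B]`, `deriv γ` one-signed on `[A, B]`, `γ A ≠ γ B` ⇒ the supersonic oblique profile `Φ` is constant.

[folklore] (compactness + identity principle + the tree's two-sided Lax/John theorems.)
-/

noncomputable section

namespace Summit.NavierStokesRegularity.NavierStokesRegularity.Theorems.PoloidalWindowDoorPoloidalWindowRigidityZShockRangeLocalAnalytic

-- the summit and its single sub-problem share the name (CONVENTIONS §1)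
set_option linter.dupNamespace false

open Set Filter Topology Function
open Summit.NavierStokesRegularity.NavierStokesRegularity.Theorems.PoloidalWindowDoorPoloidalWindowRigidityZShockRangeLocal
open Summit.NavierStokesRegularity.NavierStokesRegularity.Theorems.PoloidalWindowDoorPoloidalWindowRigidityZShockRangeLocalAntitone

/-! ### Compactness bookkeeping on the hull -/

/-- On a compact hull an analytic structure function has: `HasDerivAt` with derivative `deriv κ`, continuous `deriv κ`, a positive lower
bound (if positive) and a bound on `|deriv κ|`. [folklore] -/
theorem analytic_hull_data {κ : ℝ → ℝ} {A B : ℝ} (hAB : A ≤ B) (hκ : AnalyticOnNhd ℝ κ (Icc A B))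
    (hpos : ∀ v ∈ Icc A B, 0 < κ v) :
    (∀ v ∈ Icc A B, HasDerivAt κ (deriv κ v) v) ∧ ContinuousOn (deriv κ) (Icc A B) ∧
      (∃ κlo : ℝ, 0 < κlo ∧ ∀ v ∈ Icc A B, κlo ≤ κ v) ∧ ∃ k₁ : ℝ, ∀ v ∈ Icc A B, |deriv κ v| ≤ k₁ := by
  have hd : ∀ v ∈ Icc A B, HasDerivAt κ (deriv κ v) v := fun v hv => (hκ v hv).differentiableAt.hasDerivAt
  have hdc : ContinuousOn (deriv κ) (Icc A B) := hκ.deriv.continuousOn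
  have hκc : ContinuousOn κ (Icc A B) := hκ.continuousOn
  obtain ⟨v₀, hv₀, hmin⟩ := isCompact_Icc.exists_isMinOn (nonempty_Icc.2 hAB) hκc
  obtain ⟨k₁, hk₁⟩ := isCompact_Icc.exists_bound_of_continuousOn hdc
  refine ⟨hd, hdc, ⟨κ v₀, hpos v₀ hv₀, fun v hv => hmin hv⟩, k₁, fun v hv => ?_⟩
  have h := hk₁ v hv
  rwa [Real.norm_eq_abs] at h

/-! ### R2 in the analytic category -/

/-- ★ **R2, scalar currency, ANALYTIC SPEED on the hull (`deriv κ ≥ 0`).**  `w : ℝ × ℝ → ℝ` two-sided `C²`, values in `[A, B]`,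
`w_x, w_z` bounded, solving `w_zz = ∂ₓ(κ(w)² w_x)`; `κ` analytic at every point of `[A, B]`, positive there, `deriv κ ≥ 0` on `[A, B]` and
`κ A ≠ κ B`.  Then `w` is constant. [folklore] -/
theorem scalarWave_const_of_analytic_speed {w : ℝ × ℝ → ℝ} {κ : ℝ → ℝ} {A B W₁ W₂ : ℝ}
    (hw : ContDiff ℝ 2 w) (hrange : ∀ q, w q ∈ Icc A B) (hκ : AnalyticOnNhd ℝ κ (Icc A B))
    (hpde : ∀ q : ℝ × ℝ, fderiv ℝ (fun q' => fderiv ℝ w q' (1, 0)) q (1, 0) =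
      fderiv ℝ (fun q' => κ (w q') ^ 2 * fderiv ℝ w q' (0, 1)) q (0, 1))
    (hpos : ∀ v ∈ Icc A B, 0 < κ v) (hmono : ∀ v ∈ Icc A B, 0 ≤ deriv κ v) (hne : κ A ≠ κ B)
    (hW₁ : ∀ q, |fderiv ℝ w q (0, 1)| ≤ W₁) (hW₂ : ∀ q, |fderiv ℝ w q (1, 0)| ≤ W₂) :
    ∀ q q' : ℝ × ℝ, w q = w q' := by
  have hAB : A ≤ B := (hrange 0).1.trans (hrange 0).2
  obtain ⟨hd, hdc, ⟨κlo, hκlo0, hκlo⟩, k₁, hk₁⟩ := analytic_hull_data hAB hκ hpos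
  exact scalarWave_const_rangeLocal hw hrange hd hdc hpde hκlo0 hκlo hmono (gn_deriv_of_analyticOnNhd hκ hne) hk₁ hW₁ hW₂

/-- ★ **R2, scalar currency, ANALYTIC SPEED on the hull (`deriv κ ≤ 0`).** [folklore] -/
theorem scalarWave_const_of_analytic_speed_antitone {w : ℝ × ℝ → ℝ} {κ : ℝ → ℝ} {A B W₁ W₂ : ℝ}
    (hw : ContDiff ℝ 2 w) (hrange : ∀ q, w q ∈ Icc A B) (hκ : AnalyticOnNhd ℝ κ (Icc A B))
    (hpde : ∀ q : ℝ × ℝ, fderiv ℝ (fun q' => fderiv ℝ w q' (1, 0)) q (1, 0) =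
      fderiv ℝ (fun q' => κ (w q') ^ 2 * fderiv ℝ w q' (0, 1)) q (0, 1))
    (hpos : ∀ v ∈ Icc A B, 0 < κ v) (hanti : ∀ v ∈ Icc A B, deriv κ v ≤ 0) (hne : κ A ≠ κ B)
    (hW₁ : ∀ q, |fderiv ℝ w q (0, 1)| ≤ W₁) (hW₂ : ∀ q, |fderiv ℝ w q (1, 0)| ≤ W₂) :
    ∀ q q' : ℝ × ℝ, w q = w q' := by
  have hAB : A ≤ B := (hrange 0).1.trans (hrange 0).2
  obtain ⟨hd, hdc, ⟨κlo, hκlo0, hκlo⟩, k₁, hk₁⟩ := analytic_hull_data hAB hκ hpos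
  exact scalarWave_const_rangeLocal_antitone hw hrange hd hdc hpde hκlo0 hκlo hanti (gn_deriv_of_analyticOnNhd hκ hne) hk₁ hW₁ hW₂

/-! ### R2½ in the analytic category -/

/-- ★ **R2½, ANALYTIC SQUARED SPEED on the hull (`deriv γ ≥ 0`).**  `Φ : ℝ × ℝ → ℝ` `C²`, values in `[A, B]`, `∂₀Φ, ∂₁Φ` bounded,
solving `∂₀(γ(Φ)∂₀Φ) = ∂₁((κ₀² − γ(Φ))∂₁Φ)`; `γ` analytic at every point of `[A, B]`, `0 < γ < κ₀²` there (supersonic drift on the values),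
`deriv γ ≥ 0` on `[A, B]`, `γ A ≠ γ B`.  Then `Φ` is constant. [folklore] -/
theorem obliqueProfile_const_of_analytic_speed {Φ : ℝ × ℝ → ℝ} {γ : ℝ → ℝ} {A B κ₀ Φ₁ Φ₂ : ℝ}
    (hΦ : ContDiff ℝ 2 Φ) (hrange : ∀ q, Φ q ∈ Icc A B) (hγ : AnalyticOnNhd ℝ γ (Icc A B))
    (hpde : ∀ q : ℝ × ℝ, fderiv ℝ (fun q' => γ (Φ q') * fderiv ℝ Φ q' (1, 0)) q (1, 0) =
      fderiv ℝ (fun q' => (κ₀ ^ 2 - γ (Φ q')) * fderiv ℝ Φ q' (0, 1)) q (0, 1))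
    (hpos : ∀ r ∈ Icc A B, 0 < γ r) (hsuper : ∀ r ∈ Icc A B, γ r < κ₀ ^ 2)
    (hmono : ∀ r ∈ Icc A B, 0 ≤ deriv γ r) (hne : γ A ≠ γ B)
    (hΦ₁ : ∀ q, |fderiv ℝ Φ q (0, 1)| ≤ Φ₁) (hΦ₂ : ∀ q, |fderiv ℝ Φ q (1, 0)| ≤ Φ₂) :
    ∀ q q' : ℝ × ℝ, Φ q = Φ q' := by
  have hAB : A ≤ B := (hrange 0).1.trans (hrange 0).2
  obtain ⟨hd, hdc, ⟨γlo, hγlo0, hγlo⟩, g₁, hg₁⟩ := analytic_hull_data hAB hγ hpos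
  exact obliqueProfile_const_of_supersonic_rangeLocal hΦ hrange hd hdc hpde hγlo0 hγlo hsuper hmono
    (gn_deriv_of_analyticOnNhd hγ hne) hg₁ hΦ₁ hΦ₂

/-- ★ **R2½, ANALYTIC SQUARED SPEED on the hull (`deriv γ ≤ 0`).** [folklore] -/
theorem obliqueProfile_const_of_analytic_speed_antitone {Φ : ℝ × ℝ → ℝ} {γ : ℝ → ℝ} {A B κ₀ Φ₁ Φ₂ : ℝ}
    (hΦ : ContDiff ℝ 2 Φ) (hrange : ∀ q, Φ q ∈ Icc A B) (hγ : AnalyticOnNhd ℝ γ (Icc A B))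
    (hpde : ∀ q : ℝ × ℝ, fderiv ℝ (fun q' => γ (Φ q') * fderiv ℝ Φ q' (1, 0)) q (1, 0) =
      fderiv ℝ (fun q' => (κ₀ ^ 2 - γ (Φ q')) * fderiv ℝ Φ q' (0, 1)) q (0, 1))
    (hpos : ∀ r ∈ Icc A B, 0 < γ r) (hsuper : ∀ r ∈ Icc A B, γ r < κ₀ ^ 2)
    (hanti : ∀ r ∈ Icc A B, deriv γ r ≤ 0) (hne : γ A ≠ γ B)
    (hΦ₁ : ∀ q, |fderiv ℝ Φ q (0, 1)| ≤ Φ₁) (hΦ₂ : ∀ q, |fderiv ℝ Φ q (1, 0)| ≤ Φ₂) :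
    ∀ q q' : ℝ × ℝ, Φ q = Φ q' := by
  have hAB : A ≤ B := (hrange 0).1.trans (hrange 0).2
  obtain ⟨hd, hdc, ⟨γlo, hγlo0, hγlo⟩, g₁, hg₁⟩ := analytic_hull_data hAB hγ hpos
  exact obliqueProfile_const_of_supersonic_rangeLocal_antitone hΦ hrange hd hdc hpde hγlo0 hγlo hsuper hanti
    (gn_deriv_of_analyticOnNhd hγ hne) hg₁ hΦ₁ hΦ₂

end Summit.NavierStokesRegularity.NavierStokesRegularity.Theorems.PoloidalWindowDoorPoloidalWindowRigidityZShockRangeLocalAnalytic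

end
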